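import Literature.Probability.RandomPlanarGeometry.HexSAWSurfaceWallRenewalSecondGap

/-!
# The iterated gap: every near-renewal of an irreducible wall bridge costs two columns of span

For the self-avoiding walk on the honeycomb lattice (brick-wall frame) in the half-plane `Y ≤ 0`, an IRREDUCIBLE
POSITIVE WALL BRIDGE `ω ∈ ipwb n` (`n ≥ 4`) with `v = visits n ω` surface visits has span `X_n ≥ 2v + 2` (the gap count
of `HexSAWSurfaceWallRenewalSixStep` / `…SixStepRigid`), and `X_n ≥ 2v + 4` as soon as it has a NEAR-RENEWAL visit time
`4 ≤ t < n` (`NearRenewal`: the walk steps right from `(X_t, 0)`, every earlier column is `≤ X_t − 1`, every later one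
`≥ X_t`; the second-gap lemma `two_mul_visits_add_four_le_apply_of_nearRenewal` of `HexSAWSurfaceWallRenewalSecondGap`).
This module iterates the second gap over ALL such times:

* `two_mul_visits_add_two_add_two_mul_card_le_apply` — the ITERATED GAP: if `T` is a set of near-renewal visit times
  `4 ≤ t < n` of `ω ∈ ipwb n`, then `X_n ≥ 2v + 2 + 2·#T`.  The located gap of the initial wall run (an even column
  `g₀ ≤ X_t` for every `t ∈ T`) and, for each `t ∈ T`, the located gap `g_t ≥ X_t + 2` after the dive ending the wall run
  that leaves `(X_t, 0)` to the right (the walk must come back to the column `X_t` at depth, `exists_deep_return_of_nearRenewal`)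
  are `#T + 1` DISTINCT even columns of `(0, X_n]` carrying no visit: for `t < u` in `T`, the time `u` comes after the dive of
  `t` (a visit time inside the wall run after `t` has the deep return to the column `X_t < X_u` in its future, against the
  tail condition of `u`), so the head condition of `u` puts the dive column of `t` at `≤ X_u − 1`, i.e. `g_t ≤ X_u < g_u`.
  The `v` visit abscissae are further distinct even numbers in `(0, X_n]`.
* `two_mul_visits_add_two_add_two_mul_card_nearRenewal_le_apply` — the same with `T = E₄`, the set
  `((wallTimes n ω).erase n).filter (4 ≤ · ∧ NearRenewal n ω ·)` of interior near-renewal visit times `≥ 4`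
  (`m = #E₄`): `2v + 2 + 2m ≤ X_n`.
* `apply_add_two_mul_card_stepsD_add_four_mul_visits_le_add` — the sharp down-step count of `…SecondGap`
  (`X_n + 2·#down + 4v ≤ n + 4 + 2·#E`, `E` = all interior near-renewal visit times) with `#E ≤ m + 1` (the only even
  time in `[1, 4)` is `2`): `X_n + 2·#down + 4v ≤ n + 6 + 2m`.
* `two_mul_card_stepsD_add_six_mul_visits_le` — adding the two: `2·#down + 6v ≤ n + 4`, i.e. an irreducible positive wall
  bridge at slack `n − 6v = 2j` has AT MOST `j + 2` DOWN STEPS (the tree's `card_stepsD_add_six_mul_visits_le` gives `2j + 2`).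
* `four_mul_card_add_six_mul_visits_le` — with `X_n + #down + 4v ≤ n + 4` (`apply_add_card_stepsD_add_four_mul_visits_le`)
  and `2·#T ≤ #down` (`two_mul_card_nearRenewal_le_card_stepsD`): `4·#T + 6v ≤ n + 2`, i.e. at slack `2j` there are at most
  `(j + 1)/2` interior near-renewal visit times `≥ 4`.
* `two_le_card_stepsD_of_two_le_visits` — `#down ≥ 2` as soon as `v ≥ 2` (one down step means `X_n = n − 2`,
  `apply_eq_sub_two_of_card_stepsD_eq_one`), and `slack_four_counts` — the numerical skeleton of SLACK FOUR (`n = 6k + 4`,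
  `v = k ≥ 2`): `X ∈ {2k+2, 2k+4, 2k+6}`, `2 ≤ #down = #up ≤ 4`, `m ≤ 1`, `#E ≤ 2`, and the implications
  `X = 2k+6 ⇒ #down = 2, #E = 1`; `X = 2k+2 ⇒ m = 0, #E ≤ 1, (#down = 4 ⇒ #E = 1)`;
  `X = 2k+4 ⇒ (#down = 4 ⇒ #E = 2, m = 1), (#down = 3 ⇒ #E = 1), (#down = 2 ⇒ #E ≤ 1)` — the prunings behind the lane's
  complete enumeration of the slack-four blocks (its classification is the business of successor modules).

PROOFS.  §1 is the proof of `two_mul_visits_add_four_le_apply_of_nearRenewal` run over the finite set `T`: the first dive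
exists because an irreducible piece of length `≥ 4` has a down step (`one_le_card_stepsD`) and is found, like the dive
after each `t ∈ T`, as the first non-conforming time of the wall run (`Nat.find`); the down steps are read off
`brickWallGraph_adj_coord`; the located gaps are `wallTimes_apply_ne_of_dive`; the gap columns are chosen by
`Classical.choose` and the count is `card_le_card_of_injOn` of `t ↦ X_t/2` into `Icc 1 (X_n/2)` minus the `#T + 1`
half-gaps (`card_sdiff_add_card_eq_card`, `card_insert_of_notMem`, `card_image_of_injOn`).  §2 is linear arithmetic over
the faces of `…SixStepRigid` §1, `…SecondGap` §1, §5 and `…SixStep`; so is §3.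

STATUS: lane theorem of the a-idea-1 bridge/renewal lineage (cars 71 `…SixStep`, 73 `…SixStepRigid`, 74b-α `…SecondGap`);
this is car 75-α «iterated gap», the span half of the classification of irreducible positive wall bridges at slack four and
higher (lane notes FINDING-HEX-WALL-SLACK-FOUR-LAW §4b, PROOF-Gstar).  OURS (new in writing, modest): the iterated-gap
inequality `X_n ≥ 2v + 2 + 2m` and its corollaries `#down ≤ (n − 6v)/2 + 2`, `4m + 6v ≤ n + 2`, the slack-four counts; checked
against the lane's enumeration of all irreducible positive wall bridges of length `≤ 32` (no failure; equality
`X_n = 2v + 2 + 2m` attained `2330` times at `n = 32`; at slack four, `k ≤ 11`, exactly the nine classes listed at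
`slack_four_counts` occur).  The printed sources carry the renewal / irreducible-bridge structure (Madras–Slade §4.2,
Definition 4.2.1, and the remark before (4.2.21), p. 94, that an irreducible bridge of span `L` has at least `3L` steps;
Definition 1.2.4; Kesten), the brickwork frame of the honeycomb lattice (Enting–Jensen §7.4.2, Fig. 7.10) and the
surface-visit statistic (Beaton et al. §3.1) — none states these counts.  No `set_option maxHeartbeats` line is used.
-/

namespace Literature.Probability.RandomPlanarGeometry.SAW.HexBW.Wall

open Finset Filter Function
open Literature.Probability.LatticeModels Literature.Probability.Percolation SimpleGraph

variable {n : ℕ} {ω : ℕ → Site 2}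

/-- [folklore] Two coordinates determine a site of `ℤ²`. -/
private theorem site_ext_igap {p q : Site 2} (h0 : p 0 = q 0) (h1 : p 1 = q 1) : p = q := by
  funext k
  fin_cases k
  · exact h0
  · exact h1

/-! ### §1 The iterated gap: `#T + 1` located gaps for a set `T` of near-renewal visit times `≥ 4` -/

/-- **The iterated gap.** If `T` is a set of near-renewal visit times `t` of an irreducible positive wall bridge of
length `n ≥ 4` with `v` visits, all with `4 ≤ t < n`, then the span is `X_n ≥ 2v + 2 + 2·#T`: the located gap of the
initial wall run is an even column `≤ X_t` for every `t ∈ T`, the wall run leaving each `(X_t, 0)` (`t ∈ T`) to the right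
ends in a dive whose located gap is an even column `≥ X_t + 2` and `≤ X_u` for every later `u ∈ T` (the time `u` comes
after that dive, since the deep return to the column `X_t < X_u` lies in the future of every visit time of that wall
run), so the `#T + 1` gaps are distinct, and the `v` visit abscissae are distinct even numbers in `(0, X_n]` avoiding them.
NEW, a-idea-1 lineage («iterated gap lemma», PROOF-Gstar); the case `#T = 1` is
`two_mul_visits_add_four_le_apply_of_nearRenewal`. [cite: MadrasSlade1993, §4.2, Definition 4.2.1 and remark before (4.2.21) (p. 94)] -/
theorem two_mul_visits_add_two_add_two_mul_card_le_apply (hω : ω ∈ ipwb n) (hn : 4 ≤ n) {T : Finset ℕ}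
    (hT : ∀ t ∈ T, t ∈ wallTimes n ω ∧ t < n ∧ 4 ≤ t ∧ NearRenewal n ω t) :
    2 * (visits n ω : ℤ) + 2 + 2 * #T ≤ ω n 0 := by
  classical
  obtain ⟨hp, hn1, hirr⟩ := mem_ipwb.1 hω
  obtain ⟨hw, hb⟩ := mem_pwb.1 hp
  obtain ⟨ha, -⟩ := mem_wbr.1 hw
  obtain ⟨hh, hn2, hYn⟩ := mem_archs.1 ha
  obtain ⟨hs, hhp⟩ := mem_hpw.1 hh
  obtain ⟨h0, hend, hbw, hinj⟩ := mem_saws_iff.1 hs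
  have hX0 : ω 0 0 = 0 := by rw [h0]; rfl
  have hY0 : ω 0 1 = 0 := by rw [h0]; rfl
  have hinj' : ∀ {a b}, a ≤ n → b ≤ n → ω a 0 = ω b 0 → ω a 1 = ω b 1 → a = b := fun {a b} ha' hb' h0' h1' =>
    hinj (show a ∈ {k | k ≤ n} from ha') (show b ∈ {k | k ≤ n} from hb') (site_ext_igap h0' h1')
  have hmemW : ∀ {t}, t ∈ wallTimes n ω ↔ (1 ≤ t ∧ t ≤ n) ∧ t % 2 = 0 ∧ ω t 1 = 0 := fun {t} => by
    rw [wallTimes, Finset.mem_filter, Finset.mem_Icc]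
  -- parity and range facts
  have hWeven : ∀ {t'}, t' ∈ wallTimes n ω → ω t' 0 % 2 = 0 ∧ 0 < ω t' 0 ∧ ω t' 0 ≤ ω n 0 := fun {t'} ht' => by
    obtain ⟨⟨ht1', htn'⟩, ht2', hy⟩ := hmemW.1 ht'
    have hpar := parity_apply hs htn'
    rw [hy, add_zero] at hpar
    have hbt := hb t' ht1' htn'
    rw [hX0] at hbt
    exact ⟨by omega, hbt.1, hbt.2⟩
  have hWinj : ∀ {a b}, a ∈ wallTimes n ω → b ∈ wallTimes n ω → ω a 0 = ω b 0 → a = b := fun {a b} ha' hb' he => by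
    obtain ⟨⟨-, han⟩, -, hya⟩ := hmemW.1 ha'
    obtain ⟨⟨-, hbn⟩, -, hyb⟩ := hmemW.1 hb'
    exact hinj' han hbn he (by rw [hya, hyb])
  have hXnev : ω n 0 % 2 = 0 := by
    have := parity_apply hs le_rfl; rw [hYn, add_zero] at this; omega
  -- `X_n ≥ 4` (the gap count of the tree, and `v ≥ 1`: the endpoint is a visit)
  have hXn4 : 4 ≤ ω n 0 := by
    have h := two_mul_visits_add_two_le_apply hω hn
    rw [visits_eq_card] at h
    have hv : 0 < #(wallTimes n ω) := Finset.card_pos.2 ⟨n, hmemW.2 ⟨⟨hn1, le_rfl⟩, hn2, hYn⟩⟩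
    omega
  -- the first step is `(0,0) → (1,0)`
  have h1X : ω 1 0 = 1 ∧ ω 1 1 = 0 := by
    have hadj' : brickWallGraph.Adj (ω 0) (ω 1) := hbw 0 (by omega)
    have hadj := (brickWallGraph_adj_coord _ _).1 hadj'
    have hpos := (hb 1 le_rfl (by omega)).1
    have hle := hhp 1 (by omega)
    rw [hX0] at hpos
    rw [hX0, hY0] at hadj
    rcases hadj with ⟨h01, h11⟩ | ⟨h00, ⟨h1a, -⟩ | ⟨h1a, h1b⟩⟩
    · exact ⟨by omega, by rw [h11]⟩
    · exfalso; omega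
    · exfalso; rw [← h00] at h1b; omega
  -- GAP ZERO: an even `g₀ ≥ 2`, never a visit abscissa, with `g₀ ≤ X_u` for every `u ∈ T`
  obtain ⟨g₀, hg₀2, hg₀L, hg₀e, hg₀W, hg₀T⟩ : ∃ g : ℤ, 2 ≤ g ∧ g ≤ ω n 0 ∧ g % 2 = 0 ∧
      (∀ t' ∈ wallTimes n ω, ω t' 0 ≠ g) ∧ ∀ u ∈ T, g ≤ ω u 0 := by
    by_cases h2 : ω 2 0 = 2 ∧ ω 2 1 = 0
    · -- the initial wall run `(0,0), …, (a,0)` and its dive at the odd column `a = b - 1`; a dive exists because an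
      -- irreducible piece of length `≥ 4` has a down step
      obtain ⟨i₀, hi₀⟩ : (stepsD n ω).Nonempty := Finset.card_pos.1 (by have := one_le_card_stepsD hω hn; omega)
      rw [stepsD, Finset.mem_filter, Finset.mem_range] at hi₀
      obtain ⟨hi₀n, -, hi₀D⟩ := hi₀
      have hexQ : ∃ i, i ≤ n ∧ ¬ (ω i 0 = i ∧ ω i 1 = 0) :=
        ⟨i₀ + 1, by omega, fun h => by have := hhp i₀ (by omega); omega⟩
      obtain ⟨hbn, hbQ⟩ := Nat.find_spec hexQ
      have hQ : ∀ j, j < Nat.find hexQ → ω j 0 = j ∧ ω j 1 = 0 := fun j hj => by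
        have := Nat.find_min hexQ hj
        push Not at this
        exact this (by omega)
      set b := Nat.find hexQ with hbdef
      have hb3 : 3 ≤ b := by
        by_contra hlt
        have h012 : b = 0 ∨ b = 1 ∨ b = 2 := by omega
        rcases h012 with h | h | h <;> rw [h] at hbQ
        · exact hbQ ⟨by rw [hX0]; norm_num, hY0⟩
        · exact hbQ ⟨by rw [h1X.1]; norm_num, h1X.2⟩
        · exact hbQ ⟨by rw [h2.1]; norm_num, h2.2⟩
      obtain ⟨hQa0, hQa1⟩ := hQ (b - 1) (by omega)
      obtain ⟨hQp0, hQp1⟩ := hQ (b - 2) (by omega)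
      have hadj := (brickWallGraph_adj_coord _ _).1 (hbw (b - 1) (by omega))
      rw [show b - 1 + 1 = b by omega] at hadj
      have hbY : ω b 0 = ω (b - 1) 0 ∧ ω b 1 = -1 ∧ (ω (b - 1) 0) % 2 = 1 := by
        rcases hadj with ⟨h01 | h01, h11⟩ | ⟨h00, ⟨h1a, -⟩ | ⟨h1a, h1b⟩⟩
        · exfalso; exact hbQ ⟨by rw [h01, hQa0]; omega, by rw [h11, hQa1]⟩
        · exfalso
          have := hinj' (a := b) (b := b - 2) hbn (by omega) (by rw [hQp0]; omega)
            (by rw [h11, hQa1, hQp1])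
          omega
        · exfalso; have := hhp b hbn; rw [hQa1] at h1a; omega
        · rw [hQa1] at h1a; rw [h00] at h1b
          exact ⟨h00, by omega, by omega⟩
      obtain ⟨-, hbY1, hodd⟩ := hbY
      refine ⟨ω (b - 1) 0 + 1, by rw [hQa0]; omega, ?_, by omega, ?_, fun u hu => ?_⟩
      · have := (hb (b - 1) (by omega) (by omega)).2
        omega
      · exact wallTimes_apply_ne_of_dive hp (i := b - 1) (by omega) hQa1
          (by rw [show b - 1 - 1 = b - 2 by omega, hQp0, hQa0]; omega) (by rw [show b - 1 + 1 = b by omega, hbY1])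
      · -- the dive happens before `u` (else the visit at time `2` would be a wall-renewal time), so `a ≤ X_u - 1`
        obtain ⟨-, hun, hu4, -, huhead, hutail⟩ := hT u hu
        have hbu : b - 1 < u := by
          by_contra hle
          have hub : u < b := by omega
          obtain ⟨hxu, -⟩ := hQ u hub
          refine hirr 2 (by norm_num) (by omega)
            ⟨⟨by omega, fun i hi1 hi2 => ?_, fun j hj1 hj2 => ?_⟩, by decide, h2.2⟩
          · rw [hX0, h2.1]
            rcases show i = 1 ∨ i = 2 by omega with h | h <;> subst h
            · rw [h1X.1]; norm_num
            · rw [h2.1]; norm_num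
          · dsimp only
            rw [show (2 : ℕ) + 0 = 2 from rfl, h2.1, show 2 + (n - 2) = n by omega]
            refine ⟨?_, (hb (2 + j) (by omega) (by omega)).2⟩
            by_cases hjb : 2 + j < b
            · rw [(hQ (2 + j) hjb).1]; push_cast; omega
            · have := hutail (2 + j) (by omega) (by omega)
              have hx4 : (4 : ℤ) ≤ ω u 0 := by rw [hxu]; exact_mod_cast hu4
              omega
        have := huhead (b - 1) hbu
        omega
    · -- `(2, 0)` is never visited
      refine ⟨2, le_rfl, by omega, by decide, fun t' ht' he => ?_, fun u hu => ?_⟩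
      · obtain ⟨⟨ht1', htn'⟩, ht2', hy⟩ := hmemW.1 ht'
        have htn'' : t' < n := by
          rcases lt_or_eq_of_le htn' with h | h
          · exact h
          · exfalso
            rw [h] at he
            omega
        obtain ⟨⟨hx1, hy1⟩, ⟨hx0', hy0'⟩, hne⟩ := wall_steps_horizontal hp ht1' htn'' ht2' hy
        rcases hx0' with hx0' | hx0'
        · have hx1' : ω (t' + 1) 0 = 1 := by omega
          have := hinj' (a := t' + 1) (b := 1) (by omega) (by omega) (by rw [hx1', h1X.1]) (by rw [hy1, h1X.2])
          omega
        · have := hinj' (a := t' - 1) (b := 1) (by omega) (by omega) (by rw [hx0', he, h1X.1]; norm_num)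
            (by rw [hy0', h1X.2])
          have ht'' : t' = 2 := by omega
          subst ht''
          exact h2 ⟨he, hy⟩
      · obtain ⟨-, -, hu4, -, huhead, -⟩ := hT u hu
        have := huhead 1 (by omega)
        rw [h1X.1] at this
        omega
  -- THE GAPS AFTER THE NEAR-RENEWALS: for `t ∈ T` an even `g ≥ X_t + 2`, never a visit abscissa, `≤ X_u` for later `u ∈ T`
  have hgap : ∀ t ∈ T, ∃ g : ℤ, ω t 0 + 2 ≤ g ∧ g ≤ ω n 0 ∧ g % 2 = 0 ∧ (∀ t' ∈ wallTimes n ω, ω t' 0 ≠ g) ∧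
      ∀ u ∈ T, t < u → g ≤ ω u 0 := by
    intro t htT
    obtain ⟨ht, htn, -, hR, hhead, htail⟩ := hT t htT
    obtain ⟨⟨ht1, -⟩, ht2, hYt⟩ := hmemW.1 ht
    set x := ω t 0 with hxdef
    obtain ⟨hxev, hxpos, hxle⟩ := hWeven ht
    -- the deep return after `t`
    obtain ⟨s, hts, hsn, hsx, hsy⟩ := exists_deep_return_of_nearRenewal hω ht1 htn ht2 hYt ⟨hR, hhead, htail⟩
    -- the wall run after `t` and its dive at the odd column `a' = x + b' - 1`
    have hY1 : ω (t + 1) 1 = 0 := (wall_steps_horizontal hp ht1 htn ht2 hYt).1.2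
    have hexQ' : ∃ j, t + j ≤ n ∧ ¬ (ω (t + j) 0 = x + j ∧ ω (t + j) 1 = 0) :=
      ⟨s - t, by omega, fun h => by rw [show t + (s - t) = s by omega] at h; rw [h.2] at hsy; norm_num at hsy⟩
    obtain ⟨hbn', hbQ'⟩ := Nat.find_spec hexQ'
    have hQ' : ∀ j, j < Nat.find hexQ' → ω (t + j) 0 = x + j ∧ ω (t + j) 1 = 0 := fun j hj => by
      have := Nat.find_min hexQ' hj
      push Not at this
      exact this (by omega)
    set b' := Nat.find hexQ' with hb'def
    have hb'2 : 2 ≤ b' := by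
      by_contra hlt
      have h01 : b' = 0 ∨ b' = 1 := by omega
      rcases h01 with h | h <;> rw [h] at hbQ'
      · exact hbQ' ⟨by simp [hxdef], by simpa using hYt⟩
      · exact hbQ' ⟨by rw [hR]; simp, hY1⟩
    have hb's : b' ≤ s - t := by
      by_contra hlt
      have := (hQ' (s - t) (by omega)).1
      rw [show t + (s - t) = s by omega, hsx] at this
      omega
    obtain ⟨hQa0', hQa1'⟩ := hQ' (b' - 1) (by omega)
    obtain ⟨hQp0', hQp1'⟩ := hQ' (b' - 2) (by omega)
    have hadj' := (brickWallGraph_adj_coord _ _).1 (hbw (t + (b' - 1)) (by omega))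
    rw [show t + (b' - 1) + 1 = t + b' by omega] at hadj'
    have hbY' : ω (t + b') 1 = -1 ∧ (ω (t + (b' - 1)) 0) % 2 = 1 := by
      rcases hadj' with ⟨h01 | h01, h11⟩ | ⟨h00, ⟨h1a, -⟩ | ⟨h1a, h1b⟩⟩
      · exfalso; exact hbQ' ⟨by rw [h01, hQa0']; ring_nf; omega, by rw [h11, hQa1']⟩
      · exfalso
        have := hinj' (a := t + b') (b := t + (b' - 2)) hbn' (by omega) (by rw [hQp0']; omega)
          (by rw [h11, hQa1', hQp1'])
        omega
      · exfalso; have := hhp (t + b') hbn'; rw [hQa1'] at h1a; omega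
      · rw [hQa1'] at h1a; rw [h00] at h1b
        exact ⟨by omega, by omega⟩
    obtain ⟨hbY1', hodd'⟩ := hbY'
    refine ⟨ω (t + (b' - 1)) 0 + 1, by rw [hQa0']; omega, ?_, by omega, ?_, fun u hu htu => ?_⟩
    · have := (hb (t + (b' - 1)) (by omega) (by omega)).2
      omega
    · exact wallTimes_apply_ne_of_dive hp (i := t + (b' - 1)) (by omega) hQa1'
        (by rw [show t + (b' - 1) - 1 = t + (b' - 2) by omega, hQp0', hQa0']; ring_nf; omega)
        (by rw [show t + (b' - 1) + 1 = t + b' by omega, hbY1'])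
    · -- a later near-renewal time `u ∈ T` comes after the dive: a visit time of the wall run `t, …, t + b' - 1` has
      -- the deep return to the column `x < X_u` in its future, against the tail condition of `u`
      obtain ⟨-, -, -, -, huhead, hutail⟩ := hT u hu
      have hbu : t + b' ≤ u := by
        by_contra hlt
        obtain ⟨j, rfl⟩ : ∃ j, u = t + j := ⟨u - t, by omega⟩
        obtain ⟨hxu, -⟩ := hQ' j (by omega)
        have := hutail s (by omega) hsn
        rw [hsx] at this
        omega
      have := huhead (t + (b' - 1)) (by omega)
      omega
  -- choose the gaps
  let g : ℕ → ℤ := fun t => if h : t ∈ T then Classical.choose (hgap t h) else 0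
  have hg : ∀ t (h : t ∈ T), ω t 0 + 2 ≤ g t ∧ g t ≤ ω n 0 ∧ g t % 2 = 0 ∧ (∀ t' ∈ wallTimes n ω, ω t' 0 ≠ g t) ∧
      ∀ u ∈ T, t < u → g t ≤ ω u 0 := fun t h => by
    simp only [g, dif_pos h]; exact Classical.choose_spec (hgap t h)
  -- COUNT: the visit abscissae, halved, inject into `[1, X_n/2]` minus the `#T + 1` half-gaps
  have hinjg : Set.InjOn (fun u => g u / 2) ↑T := by
    intro a ha₁ c hc₁ he
    have ha₂ := Finset.mem_coe.1 ha₁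
    have hc₂ := Finset.mem_coe.1 hc₁
    dsimp only at he
    by_contra hne
    obtain ⟨hga, -, hgae, -, hgaT⟩ := hg a ha₂
    obtain ⟨hgc, -, hgce, -, hgcT⟩ := hg c hc₂
    rcases lt_or_gt_of_ne hne with h | h
    · have := hgaT c hc₂ h; omega
    · have := hgcT a ha₂ h; omega
  have hg₀nm : g₀ / 2 ∉ T.image (fun u => g u / 2) := fun hmem => by
    obtain ⟨u, hu, he⟩ := Finset.mem_image.1 hmem
    obtain ⟨hgu, -, hgue, -, -⟩ := hg u hu
    have := hg₀T u hu
    omega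
  have hGsub : insert (g₀ / 2) (T.image fun u => g u / 2) ⊆ Finset.Icc (1 : ℤ) (ω n 0 / 2) := by
    intro z hz
    rw [Finset.mem_Icc]
    rcases Finset.mem_insert.1 hz with rfl | hz'
    · constructor <;> omega
    · obtain ⟨u, hu, rfl⟩ := Finset.mem_image.1 hz'
      obtain ⟨hgu, hguL, -, -, -⟩ := hg u hu
      have := (hWeven (hT u hu).1).2.1
      constructor <;> omega
  have hGcard : #(insert (g₀ / 2) (T.image fun u => g u / 2)) = #T + 1 := by
    rw [Finset.card_insert_of_notMem hg₀nm, Finset.card_image_of_injOn hinjg]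
  have h1 : #(wallTimes n ω) ≤ #(Finset.Icc (1 : ℤ) (ω n 0 / 2) \ insert (g₀ / 2) (T.image fun u => g u / 2)) := by
    refine Finset.card_le_card_of_injOn (fun t' => ω t' 0 / 2) (fun t' ht' => ?_) (fun a ha₁ c hc₁ he => ?_)
    · have ht0 := Finset.mem_coe.1 ht'
      obtain ⟨he, hpos, hle⟩ := hWeven ht0
      rw [Finset.mem_coe, Finset.mem_sdiff, Finset.mem_Icc, Finset.mem_insert, Finset.mem_image]
      show (1 ≤ ω t' 0 / 2 ∧ ω t' 0 / 2 ≤ ω n 0 / 2) ∧ ¬ (ω t' 0 / 2 = g₀ / 2 ∨ ∃ u ∈ T, g u / 2 = ω t' 0 / 2)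
      refine ⟨⟨by omega, by omega⟩, ?_⟩
      rintro (h | ⟨u, hu, h⟩)
      · exact hg₀W t' ht0 (by omega)
      · obtain ⟨-, -, hgue, hguW, -⟩ := hg u hu
        exact hguW t' ht0 (by omega)
    · obtain ⟨he1, -, -⟩ := hWeven (Finset.mem_coe.1 ha₁)
      obtain ⟨he2, -, -⟩ := hWeven (Finset.mem_coe.1 hc₁)
      exact hWinj (Finset.mem_coe.1 ha₁) (Finset.mem_coe.1 hc₁) (by dsimp only at he; omega)
  have h2 := Finset.card_sdiff_add_card_eq_card hGsub
  rw [hGcard, Int.card_Icc] at h2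
  have h3 := Int.toNat_of_nonneg (show (0 : ℤ) ≤ ω n 0 / 2 + 1 - 1 by omega)
  rw [visits_eq_card]
  omega

/-! ### §2 Corollaries: the filtered form, the refined down-step count, `#down ≤ (n − 6v)/2 + 2`, `4m + 6v ≤ n + 2` -/

open Classical in
/-- [folklore] Membership in the filtered set `E₄` of interior near-renewal visit times `≥ 4`, unfolded. -/
private theorem mem_nearRenewal_four {t : ℕ}
    (ht : t ∈ ((wallTimes n ω).erase n).filter fun t => 4 ≤ t ∧ NearRenewal n ω t) :
    t ∈ wallTimes n ω ∧ t < n ∧ 4 ≤ t ∧ NearRenewal n ω t := by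
  rw [Finset.mem_filter, Finset.mem_erase] at ht
  obtain ⟨⟨htn, htW⟩, h4, hnr⟩ := ht
  have htn' : t ≤ n := by
    rw [wallTimes, Finset.mem_filter, Finset.mem_Icc] at htW
    exact htW.1.2
  exact ⟨htW, lt_of_le_of_ne htn' htn, h4, hnr⟩

open Classical in
/-- [folklore] `#E ≤ #E₄ + 1`: an interior near-renewal visit time below `4` is the time `2` (visit times are even
and `≥ 1`). -/
private theorem card_nearRenewal_le_card_four_add_one (n : ℕ) (ω : ℕ → Site 2) :
    #(((wallTimes n ω).erase n).filter fun t => NearRenewal n ω t) ≤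
      #(((wallTimes n ω).erase n).filter fun t => 4 ≤ t ∧ NearRenewal n ω t) + 1 := by
  calc #(((wallTimes n ω).erase n).filter fun t => NearRenewal n ω t)
      ≤ #(insert 2 (((wallTimes n ω).erase n).filter fun t => 4 ≤ t ∧ NearRenewal n ω t)) := by
        refine Finset.card_le_card fun t ht => ?_
        rw [Finset.mem_insert]
        rw [Finset.mem_filter] at ht
        by_cases h4 : 4 ≤ t
        · exact Or.inr (Finset.mem_filter.2 ⟨ht.1, h4, ht.2⟩)
        · have htW := (Finset.mem_erase.1 ht.1).2
          rw [wallTimes, Finset.mem_filter, Finset.mem_Icc] at htW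
          left
          omega
    _ ≤ _ := Finset.card_insert_le _ _

open Classical in
/-- **The iterated gap, filtered form (LEMMA G\*).** For an irreducible positive wall bridge of length `n ≥ 4` with `v`
visits and `m = #E₄` interior near-renewal visit times `≥ 4` (`E₄ = ((wallTimes n ω).erase n).filter (4 ≤ · ∧ NearRenewal n ω ·)`):
`2v + 2 + 2m ≤ X_n`. NEW, a-idea-1 lineage (PROOF-Gstar). [cite: MadrasSlade1993, §4.2, Definition 4.2.1 and remark before (4.2.21) (p. 94)] -/
theorem two_mul_visits_add_two_add_two_mul_card_nearRenewal_le_apply (hω : ω ∈ ipwb n) (hn : 4 ≤ n) :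
    2 * (visits n ω : ℤ) + 2 + 2 * #(((wallTimes n ω).erase n).filter fun t => 4 ≤ t ∧ NearRenewal n ω t) ≤ ω n 0 :=
  two_mul_visits_add_two_add_two_mul_card_le_apply hω hn fun _ ht => mem_nearRenewal_four ht

open Classical in
/-- **The refined down-step count.** `X_n + 2·#down + 4v ≤ n + 6 + 2m` with `m = #E₄` the number of interior
near-renewal visit times `≥ 4`: the sharp count `apply_add_two_mul_card_stepsD_add_four_mul_visits_le`
(`… ≤ n + 4 + 2·#E`) and `#E ≤ m + 1`. NEW, a-idea-1 lineage (PROOF-Gstar, Corollary D\*).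
[cite: MadrasSlade1993, §4.2, Definition 4.2.1 and remark before (4.2.21) (p. 94)] -/
theorem apply_add_two_mul_card_stepsD_add_four_mul_visits_le_add (hω : ω ∈ ipwb n) (hn : 4 ≤ n) :
    ω n 0 + 2 * #(stepsD n ω) + 4 * (visits n ω : ℤ) ≤
      n + 6 + 2 * #(((wallTimes n ω).erase n).filter fun t => 4 ≤ t ∧ NearRenewal n ω t) := by
  have h1 := apply_add_two_mul_card_stepsD_add_four_mul_visits_le hω hn
  have h2 := card_nearRenewal_le_card_four_add_one n ω
  omega

open Classical in
/-- **At most `(n − 6v)/2 + 2` down steps.** `2·#down + 6v ≤ n + 4` for an irreducible positive wall bridge of length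
`n ≥ 4` with `v` visits (the refined down-step count plus the iterated gap; the tree's `card_stepsD_add_six_mul_visits_le`
is `#down + 6v ≤ n + 2`). NEW, a-idea-1 lineage (PROOF-Gstar, Corollary D\*).
[cite: MadrasSlade1993, §4.2, Definition 4.2.1 and remark before (4.2.21) (p. 94)] -/
theorem two_mul_card_stepsD_add_six_mul_visits_le (hω : ω ∈ ipwb n) (hn : 4 ≤ n) :
    2 * #(stepsD n ω) + 6 * visits n ω ≤ n + 4 := by
  have h1 := apply_add_two_mul_card_stepsD_add_four_mul_visits_le_add hω hn
  have h2 := two_mul_visits_add_two_add_two_mul_card_nearRenewal_le_apply hω hn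
  omega

/-- **Few near-renewals.** `4·#T + 6v ≤ n + 2` for a set `T` of near-renewal visit times `4 ≤ t < n` of an irreducible
positive wall bridge of length `n ≥ 4` with `v` visits: the iterated gap `2v + 2 + 2·#T ≤ X_n`, the down-step count
`X_n + #down + 4v ≤ n + 4` and `2·#T ≤ #down` (`two_mul_card_nearRenewal_le_card_stepsD`). NEW, a-idea-1 lineage.
[cite: MadrasSlade1993, §4.2, Definition 4.2.1 and remark before (4.2.21) (p. 94)] -/
theorem four_mul_card_add_six_mul_visits_le (hω : ω ∈ ipwb n) (hn : 4 ≤ n) {T : Finset ℕ}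
    (hT : ∀ t ∈ T, t ∈ wallTimes n ω ∧ t < n ∧ 4 ≤ t ∧ NearRenewal n ω t) :
    4 * #T + 6 * visits n ω ≤ n + 2 := by
  have h1 := two_mul_visits_add_two_add_two_mul_card_le_apply hω hn hT
  have h2 := apply_add_card_stepsD_add_four_mul_visits_le hω hn
  have h3 := two_mul_card_nearRenewal_le_card_stepsD hω (T := T) fun t ht =>
    ⟨(hT t ht).1, (hT t ht).2.1, (hT t ht).2.2.2⟩
  omega

open Classical in
/-- **Few near-renewals, filtered form.** `4m + 6v ≤ n + 2` with `m = #E₄`. NEW, a-idea-1 lineage.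
[cite: MadrasSlade1993, §4.2, Definition 4.2.1 and remark before (4.2.21) (p. 94)] -/
theorem four_mul_card_nearRenewal_add_six_mul_visits_le (hω : ω ∈ ipwb n) (hn : 4 ≤ n) :
    4 * #(((wallTimes n ω).erase n).filter fun t => 4 ≤ t ∧ NearRenewal n ω t) + 6 * visits n ω ≤ n + 2 :=
  four_mul_card_add_six_mul_visits_le hω hn fun _ ht => mem_nearRenewal_four ht

/-! ### §3 At least two down steps once `v ≥ 2`; the counts at slack four (`n = 6k + 4`, `v = k`) -/

/-- **At least two down steps.** An irreducible positive wall bridge of length `n ≥ 4` with `v ≥ 2` visits has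
`#down ≥ 2`: with one down (and one up) step the profile lemma `apply_eq_sub_two_of_card_stepsD_eq_one` gives
`X_n = n − 2`, against the charge count `X_n + 4v ≤ n + 2`. (The tree's `two_le_card_stepsD_of_slack_two` is the case
`n = 6k + 2`.) NEW, a-idea-1 lineage. [cite: MadrasSlade1993, §4.2, remark before (4.2.21) (p. 94)] -/
theorem two_le_card_stepsD_of_two_le_visits (hω : ω ∈ ipwb n) (hn : 4 ≤ n) (hv : 2 ≤ visits n ω) :
    2 ≤ #(stepsD n ω) := by
  have hF2 := apply_add_four_mul_visits_le hω hn
  have hUD := card_stepsU_eq_card_stepsD hω hn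
  have hD1 := one_le_card_stepsD hω hn
  by_contra hlt
  have hD : #(stepsD n ω) = 1 := by omega
  have hX := apply_eq_sub_two_of_card_stepsD_eq_one hω hD (by rw [hUD, hD])
  omega

open Classical in
/-- [folklore] Membership in the set `E` of interior near-renewal visit times, unfolded. -/
private theorem mem_nearRenewal_erase {t : ℕ}
    (ht : t ∈ ((wallTimes n ω).erase n).filter fun t => NearRenewal n ω t) :
    t ∈ wallTimes n ω ∧ t < n ∧ NearRenewal n ω t := by
  rw [Finset.mem_filter, Finset.mem_erase] at ht
  obtain ⟨⟨htn, htW⟩, hnr⟩ := ht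
  have htn' : t ≤ n := by
    rw [wallTimes, Finset.mem_filter, Finset.mem_Icc] at htW
    exact htW.1.2
  exact ⟨htW, lt_of_le_of_ne htn' htn, hnr⟩

open Classical in
/-- **Slack four, numerically.** An irreducible positive wall bridge of length `6k + 4` (`k ≥ 2`) with `k` visits has
span `X ∈ {2k+2, 2k+4, 2k+6}`, `2 ≤ #down = #up ≤ 4`, at most ONE interior near-renewal visit time `≥ 4` (`m ≤ 1`) and at
most two interior near-renewal visit times (`#E ≤ 2`); `X = 2k + 6` forces `#down = 2` and `#E = 1`; `X = 2k + 2` forces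
`m = 0` (every interior near-renewal visit time equals `2`), `#E ≤ 1`, and `#E = 1` if `#down = 4`; `X = 2k + 4` with
`#down = 4` forces `#E = 2`, `m = 1`, with `#down = 3` forces `#E = 1`, with `#down = 2` allows `#E ≤ 1`.  (Linear
arithmetic over the gap count, the charge count, the sharp down-step count, the iterated gap, `#E ≤ m + 1`,
`4m + 6v ≤ n + 2`, `2·#E ≤ #down` and `#down ≥ 2`.)  NEW, a-idea-1 lineage (PROOF-slack4-PLAN §A; census §D: the
classes `(X − 2k − 2, #down, #E, m)` occurring for `k ≤ 11` are exactly `(0,2,0,0)`, `(0,3,0,0)`, `(0,3,1,0)`, `(0,4,1,0)`,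
`(2,2,1,0)`, `(2,3,1,0)`, `(2,3,1,1)`, `(2,4,2,1)`, `(4,2,1,0)`). [cite: MadrasSlade1993, §4.2, remark before (4.2.21) (p. 94)] -/
theorem slack_four_counts {k m : ℕ} (hk : 2 ≤ k) (hm : m = 6 * k + 4) (hω : ω ∈ ipwb m) (hv : visits m ω = k) :
    (ω m 0 = 2 * k + 2 ∨ ω m 0 = 2 * k + 4 ∨ ω m 0 = 2 * k + 6) ∧ #(stepsU m ω) = #(stepsD m ω) ∧
      2 ≤ #(stepsD m ω) ∧ #(stepsD m ω) ≤ 4 ∧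
      #(((wallTimes m ω).erase m).filter fun t => 4 ≤ t ∧ NearRenewal m ω t) ≤ 1 ∧
      #(((wallTimes m ω).erase m).filter fun t => NearRenewal m ω t) ≤ 2 ∧
      (ω m 0 = 2 * k + 6 →
        #(stepsD m ω) = 2 ∧ #(((wallTimes m ω).erase m).filter fun t => NearRenewal m ω t) = 1) ∧
      (ω m 0 = 2 * k + 2 →
        #(((wallTimes m ω).erase m).filter fun t => 4 ≤ t ∧ NearRenewal m ω t) = 0 ∧
          #(((wallTimes m ω).erase m).filter fun t => NearRenewal m ω t) ≤ 1 ∧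
          (#(stepsD m ω) = 4 → #(((wallTimes m ω).erase m).filter fun t => NearRenewal m ω t) = 1)) ∧
      (ω m 0 = 2 * k + 4 →
        (#(stepsD m ω) = 4 → #(((wallTimes m ω).erase m).filter fun t => NearRenewal m ω t) = 2 ∧
            #(((wallTimes m ω).erase m).filter fun t => 4 ≤ t ∧ NearRenewal m ω t) = 1) ∧
          (#(stepsD m ω) = 3 → #(((wallTimes m ω).erase m).filter fun t => NearRenewal m ω t) = 1) ∧
          (#(stepsD m ω) = 2 → #(((wallTimes m ω).erase m).filter fun t => NearRenewal m ω t) ≤ 1)) := by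
  classical
  have hm4 : 4 ≤ m := by omega
  have hA := two_mul_visits_add_two_le_apply hω hm4
  have hF2 := apply_add_four_mul_visits_le hω hm4
  have hUD := card_stepsU_eq_card_stepsD hω hm4
  have hS := apply_add_two_mul_card_stepsD_add_four_mul_visits_le hω hm4
  have hG := two_mul_visits_add_two_add_two_mul_card_nearRenewal_le_apply hω hm4
  have hEM := card_nearRenewal_le_card_four_add_one m ω
  have hM4 := four_mul_card_nearRenewal_add_six_mul_visits_le hω hm4
  have hD2 := two_le_card_stepsD_of_two_le_visits hω hm4 (by omega)
  have hEd : 2 * #(((wallTimes m ω).erase m).filter fun t => NearRenewal m ω t) ≤ #(stepsD m ω) :=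
    two_mul_card_nearRenewal_le_card_stepsD hω fun t ht => mem_nearRenewal_erase ht
  have hpar : ω m 0 % 2 = 0 := by
    obtain ⟨hp, -, -⟩ := mem_ipwb.1 hω
    obtain ⟨hw, -⟩ := mem_pwb.1 hp
    obtain ⟨ha, -⟩ := mem_wbr.1 hw
    obtain ⟨hh, -, hYn⟩ := mem_archs.1 ha
    obtain ⟨hs, -⟩ := mem_hpw.1 hh
    have := parity_apply hs le_rfl; rw [hYn, add_zero] at this; omega
  rw [hv] at hA hF2 hS hG hM4
  have hmZ : ((m : ℕ) : ℤ) = 6 * k + 4 := by rw [hm]; push_cast; ring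
  rw [hmZ] at hF2 hS
  refine ⟨by omega, hUD, hD2, by omega, by omega, by omega, fun h => ⟨by omega, by omega⟩,
    fun h => ⟨by omega, by omega, fun hd => by omega⟩,
    fun h => ⟨fun hd => ⟨by omega, by omega⟩, fun hd => by omega, fun hd => by omega⟩⟩

end Literature.Probability.RandomPlanarGeometry.SAW.HexBW.Wall
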